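import Mathlib
import Summits.PneNP.PneNP.Theses.OneSlice
import Summits.PneNP.PneNP.Theorems.OneSliceSliceTargetSplit
import Summits.PneNP.PneNP.Theorems.OneSliceMonotoneContinuationDefs
import Summits.PneNP.PneNP.Theorems.OneSliceSliceACZeroBinomialHazard

/-!
# Route OneSlice, crux `MonotoneContinuation` (stmt-PneNP-18471), line `Sketch_ideator1_r1` (ProfileLine) — bridge infrastructure B2

Sub-goal `shellMass`: for every `L ≥ 1` there are `c > 0` and `M₀` such that for every binomial law `Bin(N,p)` with
`0 < p ≤ 1/2` and mean `Np ≥ M₀`, writing `m := ⌊Np⌋₊`, both windows `[m + L√m, m + 2L√m]` and `[m − 2L√m, m − L√m]`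
carry mass at least `c`. Elementary proof with finite sums of reals only (no CLT):
* Chebyshev (`binomialWeight_tail_le`) puts mass `≥ 3/4` on the `≤ 8√m` levels within `3√m` of the mean, so SOME level
  `s₁` there weighs `≥ 3/(32√m)` (`shellMass_mode`);
* on the window `|s − m| ≤ 3L√m + 1` every one-step weight ratio (up or down) is `≥ 1 − δ` with `δ√m ≤ 20L`
  (`shellMass_ratio_up/down`, from the ratio identity `binomialWeight_succ_mul`), and `(1 − δ)^n ≥ e^{−2δn}` for
  `δ ≤ 1/2` (`shellMass_exp_le`); walking `≤ 6L√m` steps from `s₁` gives `binW N p s ≥ e^{−240L²}·3/(32√m)` for every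
  `s` with `|s − m| ≤ 2L√m` (`shellMass_pointwise`);
* each window contains `⌊L√m⌋₊ ≥ L√m/2` consecutive integers, whence mass `≥ c := 3L e^{−240L²}/64`; `M₀ := 1600 L²`.
-/

set_option linter.dupNamespace false

namespace Summit.PneNP.PneNP.Theorems.MonotoneContinuation

open Finset
open Classical
open Summit.PneNP.PneNP.Theorems (binomialWeight_tail_le binomialWeight_sum_range binomialWeight_nonneg
  binomialWeight_succ_mul)

noncomputable section

/-! ### Real-analysis helpers -/

/-- `e^{−2δn} ≤ (1 − δ)^n` for `0 ≤ δ ≤ 1/2` (from `1 + 2δ ≤ e^{2δ}` and `(1 − δ)(1 + 2δ) ≥ 1`). [folklore] -/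
theorem shellMass_exp_le {δ : ℝ} (h0 : 0 ≤ δ) (h1 : δ ≤ 1 / 2) (n : ℕ) :
    Real.exp (-(2 * δ * n)) ≤ (1 - δ) ^ n := by
  have key : Real.exp (-(2 * δ)) ≤ 1 - δ := by
    have h := Real.add_one_le_exp (2 * δ)
    have he : 0 < Real.exp (-(2 * δ)) := Real.exp_pos _
    have hprod : Real.exp (-(2 * δ)) * Real.exp (2 * δ) = 1 := by rw [← Real.exp_add]; simp
    have h2 : Real.exp (-(2 * δ)) * (1 + 2 * δ) ≤ (1 - δ) * (1 + 2 * δ) := by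
      calc Real.exp (-(2 * δ)) * (1 + 2 * δ) ≤ Real.exp (-(2 * δ)) * Real.exp (2 * δ) :=
            mul_le_mul_of_nonneg_left (by linarith) he.le
        _ = 1 := hprod
        _ ≤ (1 - δ) * (1 + 2 * δ) := by nlinarith
    exact le_of_mul_le_mul_right h2 (by linarith)
  have : Real.exp (-(2 * δ * n)) = Real.exp (-(2 * δ)) ^ n := by
    rw [← Real.exp_nat_mul]; ring_nf
  rw [this]
  exact pow_le_pow_left₀ (Real.exp_pos _).le key n

/-- Iterated one-step lower bound, upwards: if `ρ b(t) ≤ b(t+1)` for `a ≤ t < a + d` then `ρ^d b(a) ≤ b(a+d)`. [folklore] -/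
theorem shellMass_iter_up {b : ℕ → ℝ} {ρ : ℝ} (hρ : 0 ≤ ρ) {a d : ℕ}
    (h : ∀ t, a ≤ t → t < a + d → ρ * b t ≤ b (t + 1)) : ρ ^ d * b a ≤ b (a + d) := by
  induction d with
  | zero => simp
  | succ d ih =>
    have h1 := ih (fun t ht1 ht2 => h t ht1 (by omega))
    have h2 := h (a + d) (by omega) (by omega)
    calc ρ ^ (d + 1) * b a = ρ * (ρ ^ d * b a) := by ring
      _ ≤ ρ * b (a + d) := mul_le_mul_of_nonneg_left h1 hρ
      _ ≤ b (a + d + 1) := h2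
      _ = b (a + (d + 1)) := by rw [add_assoc]

/-- Iterated one-step lower bound, downwards: if `ρ b(t+1) ≤ b(t)` for `a ≤ t < a + d` then `ρ^d b(a+d) ≤ b(a)`. [folklore] -/
theorem shellMass_iter_down {b : ℕ → ℝ} {ρ : ℝ} (hρ : 0 ≤ ρ) {a d : ℕ}
    (h : ∀ t, a ≤ t → t < a + d → ρ * b (t + 1) ≤ b t) : ρ ^ d * b (a + d) ≤ b a := by
  induction d with
  | zero => simp
  | succ d ih =>
    have h1 := ih (fun t ht1 ht2 => h t ht1 (by omega))
    have h2 := h (a + d) (by omega) (by omega)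
    calc ρ ^ (d + 1) * b (a + (d + 1)) = ρ ^ d * (ρ * b (a + d + 1)) := by rw [← add_assoc]; ring
      _ ≤ ρ ^ d * b (a + d) := mul_le_mul_of_nonneg_left h2 (pow_nonneg hρ d)
      _ ≤ b a := h1

/-- The upward ratio condition on the window `[m − R, m + R]`: with `δ m = 4(R+1)`, `R ≤ m/2`, `m ≤ Np`, `p ≤ 1/2`,
`(1 − δ)(s+1)(1−p) ≤ (N − s)p`. [folklore] -/
theorem shellMass_ratio_up {m R δ s p Nr : ℝ} (hp0 : 0 < p) (hp2 : p ≤ 1 / 2)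
    (hmμ : m ≤ Nr * p) (hRm : R ≤ m / 2) (hδ : δ * m = 4 * (R + 1)) (hδ0 : 0 ≤ δ)
    (hs1 : m - R ≤ s) (hs2 : s ≤ m + R) :
    (1 - δ) * ((s + 1) * (1 - p)) ≤ (Nr - s) * p := by
  have h1 : δ * ((m - R + 1) * (1 / 2)) ≤ δ * ((s + 1) * (1 - p)) :=
    mul_le_mul_of_nonneg_left (mul_le_mul (by linarith) (by linarith) (by norm_num) (by linarith)) hδ0
  have h2 : δ * (m / 2) ≤ δ * (m - R + 1) := mul_le_mul_of_nonneg_left (by linarith) hδ0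
  linarith

/-- The downward ratio condition on the window `[m − R, m + R]`: with `δ m = 4(R+1)`, `R ≤ m/2`, `m ≤ Np < m + 1`,
`0 < p ≤ 1/2`, `(1 − δ)(N − s)p ≤ (s+1)(1−p)`. [folklore] -/
theorem shellMass_ratio_down {m R δ s p Nr : ℝ} (hp0 : 0 < p) (hp2 : p ≤ 1 / 2) (hmμ : m ≤ Nr * p)
    (hμm : Nr * p ≤ m + 1) (hR0 : 0 ≤ R) (hRm : R ≤ m / 2) (hδ : δ * m = 4 * (R + 1)) (hδ0 : 0 ≤ δ)
    (hs1 : m - R ≤ s) (hs2 : s ≤ m + R) :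
    (1 - δ) * ((Nr - s) * p) ≤ (s + 1) * (1 - p) := by
  have h1 : s * p ≤ (m + R) * (1 / 2) := mul_le_mul hs2 hp2 hp0.le (by linarith)
  have h2 : δ * (m / 2 - R / 2) ≤ δ * (Nr * p - s * p) := mul_le_mul_of_nonneg_left (by linarith) hδ0
  have h3 : δ * (m / 4) ≤ δ * (m / 2 - R / 2) := mul_le_mul_of_nonneg_left (by linarith) hδ0
  linarith

section Binomial

variable {N : ℕ} {p : ℝ} {b : ℕ → ℝ}

/-- One step up: `ρ (i+1)(1−p) ≤ (N−i)p` gives `ρ b(i) ≤ b(i+1)`. [folklore] -/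
theorem shellMass_step_up (hb : ∀ i, b i = (N.choose i : ℝ) * p ^ i * (1 - p) ^ (N - i))
    (hp0 : 0 ≤ p) (hp1 : p < 1) {i : ℕ} (hi : i + 1 ≤ N) {ρ : ℝ}
    (h : ρ * ((i + 1 : ℝ) * (1 - p)) ≤ ((N : ℝ) - i) * p) : ρ * b i ≤ b (i + 1) := by
  have hA : 0 < (i + 1 : ℝ) * (1 - p) := mul_pos (by positivity) (by linarith)
  have hbi : 0 ≤ b i := binomialWeight_nonneg hb hp0 hp1.le i
  have key := binomialWeight_succ_mul hb hi
  refine le_of_mul_le_mul_right ?_ hA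
  calc ρ * b i * ((i + 1 : ℝ) * (1 - p)) = b i * (ρ * ((i + 1 : ℝ) * (1 - p))) := by ring
    _ ≤ b i * (((N : ℝ) - i) * p) := mul_le_mul_of_nonneg_left h hbi
    _ = b (i + 1) * ((i + 1 : ℝ) * (1 - p)) := key.symm

/-- One step down: `ρ (N−i)p ≤ (i+1)(1−p)` gives `ρ b(i+1) ≤ b(i)`. [folklore] -/
theorem shellMass_step_down (hb : ∀ i, b i = (N.choose i : ℝ) * p ^ i * (1 - p) ^ (N - i))
    (hp0 : 0 < p) (hp1 : p ≤ 1) {i : ℕ} (hi : i + 1 ≤ N) {ρ : ℝ}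
    (h : ρ * (((N : ℝ) - i) * p) ≤ (i + 1 : ℝ) * (1 - p)) : ρ * b (i + 1) ≤ b i := by
  have hNi : (0 : ℝ) < (N : ℝ) - i := by
    have : ((i + 1 : ℕ) : ℝ) ≤ N := by exact_mod_cast hi
    push_cast at this
    linarith
  have hB : 0 < ((N : ℝ) - i) * p := mul_pos hNi hp0
  have hbi : 0 ≤ b (i + 1) := binomialWeight_nonneg hb hp0.le hp1 (i + 1)
  have key := binomialWeight_succ_mul hb hi
  refine le_of_mul_le_mul_right ?_ hB
  calc ρ * b (i + 1) * (((N : ℝ) - i) * p) = b (i + 1) * (ρ * (((N : ℝ) - i) * p)) := by ring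
    _ ≤ b (i + 1) * ((i + 1 : ℝ) * (1 - p)) := mul_le_mul_of_nonneg_left h hbi
    _ = b i * (((N : ℝ) - i) * p) := key

/-- Some level within `3√m` of the mean `Np ∈ [m, m+1)` weighs `≥ 3/(32√m)`: Chebyshev puts mass `≥ 3/4` on these
`≤ 8√m` levels. [folklore] -/
theorem shellMass_mode (hb : ∀ i, b i = (N.choose i : ℝ) * p ^ i * (1 - p) ^ (N - i))
    (hp0 : 0 < p) (hp2 : p ≤ 1 / 2) {m : ℕ} (hm : 1 ≤ m) (hmμ : (m : ℝ) ≤ N * p) (hμm : (N : ℝ) * p < m + 1) :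
    ∃ s₁ : ℕ, s₁ ≤ N ∧ |(s₁ : ℝ) - N * p| < 3 * Real.sqrt m ∧ 3 ≤ 32 * Real.sqrt m * b s₁ := by
  set q := Real.sqrt m with hq_def
  have hm1 : (1 : ℝ) ≤ m := by exact_mod_cast hm
  have hq1 : 1 ≤ q := by
    rw [hq_def, Real.le_sqrt (by norm_num) (by positivity)]
    simpa using hm1
  have hqq : q * q = m := Real.mul_self_sqrt (Nat.cast_nonneg _)
  have hbn : ∀ i, 0 ≤ b i := binomialWeight_nonneg hb hp0.le (by linarith)
  have hμ0 : 0 ≤ (N : ℝ) * p := by positivity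
  set T := (range (N + 1)).filter (fun i : ℕ => 3 * q ≤ |(i : ℝ) - N * p|) with hT
  set S := (range (N + 1)).filter (fun i : ℕ => ¬ 3 * q ≤ |(i : ℝ) - N * p|) with hS
  -- Chebyshev: the far levels `T` carry mass `≤ 1/4`
  have htail : ∑ i ∈ T, b i ≤ (N : ℝ) * p * (1 - p) / (3 * q) ^ 2 :=
    binomialWeight_tail_le hb hp0.le (by linarith) (by positivity) _ (fun i h => h)
  have hbound : (N : ℝ) * p * (1 - p) / (3 * q) ^ 2 ≤ 1 / 4 := by
    rw [div_le_iff₀ (by positivity)]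
    have : (N : ℝ) * p * (1 - p) ≤ N * p := mul_le_of_le_one_right hμ0 (by linarith)
    linarith
  have hsplit : ∑ i ∈ T, b i + ∑ i ∈ S, b i = 1 := by
    rw [← binomialWeight_sum_range hb]
    exact Finset.sum_filter_add_sum_filter_not _ _ _
  have hSmass : 3 / 4 ≤ ∑ i ∈ S, b i := by linarith
  have hSne : S.Nonempty := by
    by_contra h
    rw [Finset.not_nonempty_iff_eq_empty] at h
    rw [h, sum_empty] at hSmass
    norm_num at hSmass
  obtain ⟨s₁, hs₁S, hmax⟩ := Finset.exists_max_image S b hSne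
  have hs₁ := mem_filter.1 hs₁S
  refine ⟨s₁, Nat.lt_succ_iff.1 (mem_range.1 hs₁.1), not_le.1 hs₁.2, ?_⟩
  -- the near levels lie in a window of `≤ 2w + 2 ≤ 8q` integers, `w = ⌊3q⌋₊`
  set w := ⌊3 * q⌋₊ with hw
  have hw1 : 3 * q < w + 1 := Nat.lt_floor_add_one _
  have hw2 : (w : ℝ) ≤ 3 * q := Nat.floor_le (by positivity)
  have hsub : S ⊆ Icc (m - w) (m + 1 + w) := by
    intro i hi
    have hlt : |(i : ℝ) - N * p| < 3 * q := not_le.1 (mem_filter.1 hi).2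
    rw [abs_lt] at hlt
    rw [mem_Icc]
    constructor
    · by_contra hcon
      have h1 : ((i + w + 1 : ℕ) : ℝ) ≤ m := by exact_mod_cast (by omega)
      push_cast at h1
      linarith
    · by_contra hcon
      have h1 : ((m + w + 2 : ℕ) : ℝ) ≤ i := by exact_mod_cast (by omega)
      push_cast at h1
      linarith
  have hcard : (S.card : ℝ) ≤ 8 * q := by
    have h1 := Finset.card_le_card hsub
    rw [Nat.card_Icc] at h1
    have h2 : (S.card : ℝ) ≤ 2 * w + 2 := by exact_mod_cast h1.trans (by omega)
    linarith
  have hle : ∑ i ∈ S, b i ≤ S.card * b s₁ := by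
    rw [← nsmul_eq_mul, ← Finset.sum_const]
    exact Finset.sum_le_sum hmax
  linarith [mul_le_mul_of_nonneg_right hcard (hbn s₁)]

/-- Pointwise lower bound `binW N p s ≥ e^{−240L²}·3/(32√m)` for every level `s` with `|s − m| ≤ 2L√m`, once
`√m ≥ 40L` (walk from the heavy level of `shellMass_mode` with one-step ratios `≥ 1 − δ`, `δ√m ≤ 20L`). [folklore] -/
theorem shellMass_pointwise (hb : ∀ i, b i = (N.choose i : ℝ) * p ^ i * (1 - p) ^ (N - i))
    (hp0 : 0 < p) (hp2 : p ≤ 1 / 2) {L : ℝ} (hL : 1 ≤ L) {m : ℕ} (hmμ : (m : ℝ) ≤ N * p)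
    (hμm : (N : ℝ) * p < m + 1) (hq : 40 * L ≤ Real.sqrt m) {s : ℕ}
    (hs1 : (m : ℝ) - 2 * L * Real.sqrt m ≤ s) (hs2 : (s : ℝ) ≤ m + 2 * L * Real.sqrt m) :
    Real.exp (-(240 * L ^ 2)) * 3 / (32 * Real.sqrt m) ≤ b s := by
  set q := Real.sqrt m with hq_def
  have hq40 : (40 : ℝ) ≤ q := le_trans (by linarith) hq
  have hqpos : 0 < q := by linarith
  have hqq : q * q = m := Real.mul_self_sqrt (Nat.cast_nonneg _)
  have hLq : L * 40 ≤ L * q := mul_le_mul_of_nonneg_left hq40 (by linarith)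
  have h3q : q ≤ L * q := le_mul_of_one_le_left hqpos.le hL
  have P1 : 40 * 40 ≤ q * q := mul_le_mul hq40 hq40 (by norm_num) hqpos.le
  have P2 : 40 * L * q ≤ q * q := mul_le_mul_of_nonneg_right hq hqpos.le
  have hm1600 : (1600 : ℝ) ≤ m := by rw [← hqq]; linarith
  have hm1 : 1 ≤ m := by exact_mod_cast (show (1 : ℝ) ≤ m by linarith)
  obtain ⟨s₁, hs₁N, hs₁μ, hbs₁⟩ := shellMass_mode hb hp0 hp2 hm1 hmμ hμm
  have habs := abs_lt.1 hs₁μ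
  have hb1 : 0 ≤ b s₁ := binomialWeight_nonneg hb hp0.le (by linarith) s₁
  -- the window radius `R` and the ratio defect `δ`
  set R : ℝ := 3 * L * q + 1 with hR
  have hR0 : 0 ≤ R := by linarith
  have hRm : R ≤ (m : ℝ) / 2 := by rw [← hqq]; linarith
  have hmpos : (0 : ℝ) < m := by linarith
  set δ : ℝ := 4 * (R + 1) / m with hδ_def
  have hδm : δ * m = 4 * (R + 1) := div_mul_cancel₀ _ hmpos.ne'
  have hδ0 : 0 ≤ δ := div_nonneg (by linarith) hmpos.le
  have hδq : δ * q ≤ 20 * L := by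
    have h1 : δ * q * q ≤ 20 * L * q := by
      have e : δ * q * q = 4 * (R + 1) := by rw [mul_assoc, hqq, hδm]
      rw [e]
      linarith
    exact le_of_mul_le_mul_right h1 hqpos
  have hδhalf : δ ≤ 1 / 2 := by
    have h1 : δ * q ≤ 1 / 2 * q := by linarith
    exact le_of_mul_le_mul_right h1 hqpos
  have hρ0 : 0 ≤ 1 - δ := by linarith
  -- all levels of the window are `< N`
  have hN : (m : ℝ) + R + 1 ≤ N := by
    have h1 : (N : ℝ) * p ≤ N * (1 / 2) := mul_le_mul_of_nonneg_left hp2 (Nat.cast_nonneg _)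
    linarith
  have hup : ∀ t : ℕ, (m : ℝ) - R ≤ t → (t : ℝ) ≤ m + R → (1 - δ) * b t ≤ b (t + 1) := by
    intro t ht1 ht2
    have ht : t + 1 ≤ N := by
      have : ((t + 1 : ℕ) : ℝ) ≤ N := by push_cast; linarith
      exact_mod_cast this
    exact shellMass_step_up hb hp0.le (by linarith) ht (shellMass_ratio_up hp0 hp2 hmμ hRm hδm hδ0 ht1 ht2)
  have hdown : ∀ t : ℕ, (m : ℝ) - R ≤ t → (t : ℝ) ≤ m + R → (1 - δ) * b (t + 1) ≤ b t := by
    intro t ht1 ht2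
    have ht : t + 1 ≤ N := by
      have : ((t + 1 : ℕ) : ℝ) ≤ N := by push_cast; linarith
      exact_mod_cast this
    exact shellMass_step_down hb hp0 (by linarith) ht
      (shellMass_ratio_down hp0 hp2 hmμ hμm.le hR0 hRm hδm hδ0 ht1 ht2)
  -- `(1 - δ)^d ≥ e^{-240 L²}` for `d ≤ 6 L q`
  have hρpow : ∀ d : ℕ, (d : ℝ) ≤ 6 * L * q → Real.exp (-(240 * L ^ 2)) ≤ (1 - δ) ^ d := by
    intro d hd
    refine le_trans ?_ (shellMass_exp_le hδ0 hδhalf d)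
    rw [Real.exp_le_exp]
    have h1 : δ * d ≤ δ * (6 * L * q) := mul_le_mul_of_nonneg_left hd hδ0
    have h3 : 6 * L * (δ * q) ≤ 6 * L * (20 * L) := mul_le_mul_of_nonneg_left hδq (by linarith)
    linarith
  -- walk from `s₁` to `s`
  have hwalk : Real.exp (-(240 * L ^ 2)) * b s₁ ≤ b s := by
    rcases le_or_gt s₁ s with hle | hlt
    · obtain ⟨d, rfl⟩ := Nat.exists_eq_add_of_le hle
      push_cast at hs2
      have hd : (d : ℝ) ≤ 6 * L * q := by linarith
      have hiter := shellMass_iter_up (b := b) hρ0 (a := s₁) (d := d) (fun t ht1 ht2 => by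
        have e1 : (s₁ : ℝ) ≤ t := by exact_mod_cast ht1
        have e2 : (t : ℝ) + 1 ≤ s₁ + d := by exact_mod_cast Nat.succ_le_of_lt ht2
        exact hup t (by linarith) (by linarith))
      calc Real.exp (-(240 * L ^ 2)) * b s₁ ≤ (1 - δ) ^ d * b s₁ := mul_le_mul_of_nonneg_right (hρpow d hd) hb1
        _ ≤ b (s₁ + d) := hiter
    · obtain ⟨d, rfl⟩ := Nat.exists_eq_add_of_le hlt.le
      push_cast at habs
      have hd : (d : ℝ) ≤ 6 * L * q := by linarith
      have hiter := shellMass_iter_down (b := b) hρ0 (a := s) (d := d) (fun t ht1 ht2 => by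
        have e1 : (s : ℝ) ≤ t := by exact_mod_cast ht1
        have e2 : (t : ℝ) + 1 ≤ s + d := by exact_mod_cast Nat.succ_le_of_lt ht2
        exact hdown t (by linarith) (by linarith))
      calc Real.exp (-(240 * L ^ 2)) * b (s + d) ≤ (1 - δ) ^ d * b (s + d) :=
            mul_le_mul_of_nonneg_right (hρpow d hd) hb1
        _ ≤ b s := hiter
  have hX : 0 < Real.exp (-(240 * L ^ 2)) := Real.exp_pos _
  rw [div_le_iff₀ (by positivity)]
  calc Real.exp (-(240 * L ^ 2)) * 3 ≤ Real.exp (-(240 * L ^ 2)) * (32 * q * b s₁) :=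
        mul_le_mul_of_nonneg_left hbs₁ hX.le
    _ = 32 * q * (Real.exp (-(240 * L ^ 2)) * b s₁) := by ring
    _ ≤ 32 * q * b s := mul_le_mul_of_nonneg_left hwalk (by positivity)
    _ = b s * (32 * q) := by ring

end Binomial

/-- **B2 (`shellMass`).** For every `L ≥ 1` there are `c > 0` and `M₀` such that for every binomial law `Bin(N,p)` with `0 < p ≤ 1/2`
and mean `Np ≥ M₀`, writing `m := ⌊Np⌋₊`, both windows `[m + L√m, m + 2L√m]` and `[m − 2L√m, m − L√m]` carry mass at least `c`
(modal lower bound `≍ 1/√m` and weight ratios `1 − O(L/√m)` per step across `O(L√m)` steps). [folklore] -/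
theorem shellMass :
  ∀ (L : ℕ), 1 ≤ L → ∃ c : ℝ, 0 < c ∧ ∃ M₀ : ℝ, ∀ (N : ℕ) (p : ℝ), 0 < p → p ≤ 1 / 2 → M₀ ≤ N * p →
    c ≤ ∑ s ∈ (range (N + 1)).filter (fun s : ℕ =>
        (⌊(N : ℝ) * p⌋₊ : ℝ) + L * Real.sqrt ⌊(N : ℝ) * p⌋₊ ≤ (s : ℝ) ∧ (s : ℝ) ≤ ⌊(N : ℝ) * p⌋₊ + 2 * L * Real.sqrt ⌊(N : ℝ) * p⌋₊),
      binW N p s ∧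
    c ≤ ∑ s ∈ (range (N + 1)).filter (fun s : ℕ =>
        (⌊(N : ℝ) * p⌋₊ : ℝ) - 2 * L * Real.sqrt ⌊(N : ℝ) * p⌋₊ ≤ (s : ℝ) ∧ (s : ℝ) ≤ ⌊(N : ℝ) * p⌋₊ - L * Real.sqrt ⌊(N : ℝ) * p⌋₊),
      binW N p s := by
  intro L hL
  have hLpos : (0 : ℝ) < L := Nat.cast_pos.2 hL
  set X : ℝ := Real.exp (-(240 * (L : ℝ) ^ 2)) with hX_def
  have hX : 0 < X := Real.exp_pos _
  refine ⟨3 * L * X / 64, by positivity, 1600 * (L : ℝ) ^ 2, ?_⟩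
  intro N p hp0 hp2 hM
  set m : ℕ := ⌊(N : ℝ) * p⌋₊ with hm_def
  set q : ℝ := Real.sqrt m with hq_def
  have hL1 : (1 : ℝ) ≤ L := by exact_mod_cast hL
  have hμ0 : 0 ≤ (N : ℝ) * p := by positivity
  have hmμ : (m : ℝ) ≤ N * p := Nat.floor_le hμ0
  have hμm : (N : ℝ) * p < m + 1 := Nat.lt_floor_add_one _
  have hm1600 : 1600 * L ^ 2 ≤ m := by
    rw [hm_def, Nat.le_floor_iff hμ0]
    push_cast
    exact hM
  have hq40 : 40 * (L : ℝ) ≤ q := by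
    rw [hq_def, Real.le_sqrt (by positivity) (by positivity)]
    have : ((1600 * L ^ 2 : ℕ) : ℝ) ≤ m := by exact_mod_cast hm1600
    push_cast at this
    linarith
  have hqpos : 0 < q := by linarith
  have hqq : q * q = m := Real.mul_self_sqrt (Nat.cast_nonneg _)
  have P2 : 40 * L * q ≤ q * q := mul_le_mul_of_nonneg_right hq40 hqpos.le
  have hLq : (40 : ℝ) ≤ L * q := by linarith [le_mul_of_one_le_left hqpos.le hL1]
  have hb : ∀ i, binW N p i = (N.choose i : ℝ) * p ^ i * (1 - p) ^ (N - i) := fun i => rfl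
  have hpt : ∀ s : ℕ, (m : ℝ) - 2 * L * q ≤ s → (s : ℝ) ≤ m + 2 * L * q → X * 3 / (32 * q) ≤ binW N p s :=
    fun s hs1 hs2 => shellMass_pointwise hb hp0 hp2 hL1 hmμ hμm hq40 hs1 hs2
  have hnonneg : ∀ i, 0 ≤ binW N p i := binomialWeight_nonneg hb hp0.le (by linarith)
  -- the windows lie below `N`
  have hN : (m : ℝ) + 2 * L * q ≤ N := by
    have h1 : (N : ℝ) * p ≤ N * (1 / 2) := mul_le_mul_of_nonneg_left hp2 (Nat.cast_nonneg _)
    have h2 : 2 * L * q ≤ (m : ℝ) := by rw [← hqq]; linarith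
    linarith
  -- the integer points of the windows: offset `a = ⌈Lq⌉₊`, count `d = ⌊Lq⌋₊`
  set a : ℕ := ⌈(L : ℝ) * q⌉₊ with ha_def
  set d : ℕ := ⌊(L : ℝ) * q⌋₊ with hd_def
  have ha1 : (L : ℝ) * q ≤ a := Nat.le_ceil _
  have ha2 : (a : ℝ) < L * q + 1 := Nat.ceil_lt_add_one (by linarith)
  have hd1 : (d : ℝ) ≤ L * q := Nat.floor_le (by linarith)
  have hd2 : (L : ℝ) * q < d + 1 := Nat.lt_floor_add_one _
  have hβ : 3 * L * X / 64 ≤ d * (X * 3 / (32 * q)) := by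
    have h2d : (L : ℝ) * q ≤ 2 * d := by linarith
    have key : (d : ℝ) * (X * 3 / (32 * q)) = 3 * X / 64 * (2 * d) / q := by ring
    rw [key, le_div_iff₀ hqpos, show 3 * (L : ℝ) * X / 64 * q = 3 * X / 64 * (L * q) by ring]
    exact mul_le_mul_of_nonneg_left h2d (by positivity)
  constructor
  · -- upper window: the levels `m + a, …, m + a + d - 1`
    have hcard : (Ico (m + a) (m + a + d)).card = d := by rw [Nat.card_Ico]; omega
    refine le_trans ?_ (sum_le_sum_of_subset_of_nonneg (s := Ico (m + a) (m + a + d)) ?_ (fun i _ _ => hnonneg i))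
    · calc 3 * L * X / 64 ≤ d * (X * 3 / (32 * q)) := hβ
        _ = ∑ s ∈ Ico (m + a) (m + a + d), X * 3 / (32 * q) := by rw [sum_const, hcard, nsmul_eq_mul]
        _ ≤ ∑ s ∈ Ico (m + a) (m + a + d), binW N p s := by
          refine sum_le_sum fun s hs => ?_
          rw [Finset.mem_Ico] at hs
          have h1 : ((m + a : ℕ) : ℝ) ≤ s := by exact_mod_cast hs.1
          have h2 : ((s + 1 : ℕ) : ℝ) ≤ ((m + a + d : ℕ) : ℝ) := by exact_mod_cast hs.2
          push_cast at h1 h2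
          exact hpt s (by linarith) (by linarith)
    · intro s hs
      rw [Finset.mem_Ico] at hs
      have h1 : ((m + a : ℕ) : ℝ) ≤ s := by exact_mod_cast hs.1
      have h2 : ((s + 1 : ℕ) : ℝ) ≤ ((m + a + d : ℕ) : ℝ) := by exact_mod_cast hs.2
      push_cast at h1 h2
      rw [mem_filter, mem_range]
      refine ⟨?_, by linarith, by linarith⟩
      have : (s : ℝ) < N + 1 := by linarith
      exact_mod_cast this
  · -- lower window: the levels `m - a - d + 1, …, m - a`
    have had : a + d ≤ m := by
      have h1 : ((a + d : ℕ) : ℝ) ≤ m := by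
        push_cast
        rw [← hqq]
        linarith
      exact_mod_cast h1
    have hcard : (Ioc (m - a - d) (m - a)).card = d := by rw [Nat.card_Ioc]; omega
    refine le_trans ?_ (sum_le_sum_of_subset_of_nonneg (s := Ioc (m - a - d) (m - a)) ?_ (fun i _ _ => hnonneg i))
    · calc 3 * L * X / 64 ≤ d * (X * 3 / (32 * q)) := hβ
        _ = ∑ s ∈ Ioc (m - a - d) (m - a), X * 3 / (32 * q) := by rw [sum_const, hcard, nsmul_eq_mul]
        _ ≤ ∑ s ∈ Ioc (m - a - d) (m - a), binW N p s := by
          refine sum_le_sum fun s hs => ?_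
          rw [Finset.mem_Ioc] at hs
          have h1 : ((s + a : ℕ) : ℝ) ≤ m := by exact_mod_cast (by omega)
          have h2 : ((m + 1 : ℕ) : ℝ) ≤ ((s + a + d : ℕ) : ℝ) := by exact_mod_cast (by omega)
          push_cast at h1 h2
          exact hpt s (by linarith) (by linarith)
    · intro s hs
      rw [Finset.mem_Ioc] at hs
      have h1 : ((s + a : ℕ) : ℝ) ≤ m := by exact_mod_cast (by omega)
      have h2 : ((m + 1 : ℕ) : ℝ) ≤ ((s + a + d : ℕ) : ℝ) := by exact_mod_cast (by omega)
      push_cast at h1 h2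
      rw [mem_filter, mem_range]
      refine ⟨?_, by linarith, by linarith⟩
      have : (s : ℝ) < N + 1 := by linarith
      exact_mod_cast this

end

end Summit.PneNP.PneNP.Theorems.MonotoneContinuation
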